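import Summits.HodgeConjecture.HodgeConjecture.Theses.SevenfoldWeilCensus
import Summits.HodgeConjecture.HodgeConjecture.Theses.NodalThetaWeil
import Summits.HodgeConjecture.HodgeConjecture.Theorems.TropicalCuspLiftWeilSixfolds
import Summits.HodgeConjecture.HodgeConjecture.Theses.HeckePrymWeil
import Summits.HodgeConjecture.HodgeConjecture.Theorems.HeckePrymWeilWeilTenfoldsSqrtMinus11TensorAnchorPerryPol
import Summits.HodgeConjecture.HodgeConjecture.Theorems.HeckePrymWeilWeilSixfoldsSqrtMinus7StubHyperbolicFlat
import HarnessLib.Audit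

/-!
# Line `perry-cm-tower-all-d` — strategist skeleton (s1) for crux `WeilSixfolds`
(item stmt-HodgeConjecture-2524; routes SevenfoldWeilCensus (rank 4), NodalThetaWeil (target),
TropicalCuspLift (primary decl, route closed); the three decls are definitionally equal)

**Weil classes on Weil-type abelian sixfolds are algebraic, for EVERY `K = ℚ(√-d)`, `d ≥ 1`.**

This is the ALL-`d` port of the sibling crux's (`HeckePrymWeil.WeilSixfoldsSqrtMinus7`, stmt-1260, `d = 7`)
live line `semihomogeneous-perry-design` (lead c12), with the strategist's CM-REACH variant built in.
It DODGES the stuck goal of the registered skeleton `Lines/birth.lean` of this crux — its hardest stub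
`stub_weilSixfoldFamiliesVHC` is an instance of Grothendieck's variational Hodge conjecture in degree 6
(every VHC-shaped line of the sibling ended `blocked-on` / `open-problem`, stmt-14497) — by replacing the
ENGINE with a THEOREM IN PRINT (Perry 2026, full Buchweitz–Flenner semiregularity ⟹ the semiregular part
of `ch` stays algebraic along the family; tree fact `Perry2026_semiregularFull_remainsAlgebraic`, run through
the landed general-`n` `AnchorObject.engine_of_perry`), so that the whole open content is concentrated in ONE
object-existence statement at ONE kind of point: a polarised, Weil-charged, fully semiregular locally free
sheaf on the CM sixfold `E_K³ ⊗ … ~ E_K⁶` of each component (Stub 5), decidable design by design by finite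
`Ext`-arithmetic (Mumford's index theorem for semi-homogeneous bundles, Mukai 1978).

Stubs (5): `stub_cmAnchoredWeilFamilyAllD` (REACH: Deligne's Weil family through `A` with a CM tensor
anchor — TRUE, LNM 900 Thm 4.8 proof, any `d`; XL), `stub_perryFull` (named fact, TRUE in print),
`stub_chernCharacter` (construction debt), `stub_markmanSplit` (named fact: hyperbolic sixfolds, all `d`),
`stub_polarisedSemiregularTowerSixAllD` (HARDEST, OPEN: the design at the CM anchor, asked off the hyperbolic
anchors).  PROVED here (not a stub): `isHyperbolicWeilType_transport` — hyperbolicity is constant along the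
family (the `d`-free content of the sibling's landed `stub_hyperbolicFlat`, p156265).  Composition
`WeilSixfolds_of_stubs : …Theses.TropicalCuspLift.WeilSixfolds` (and the census / nodal copies) concludes the
crux BY NAME through the landed `Theorems.weilSixfolds_iff`; it depends on the five `sorry`s only.
-/

noncomputable section

set_option linter.dupNamespace false

open CategoryTheory AlgebraicGeometry Limits MonoidalCategory CartesianMonoidalCategory
open Literature.AlgebraicGeometry Literature.AlgebraicGeometry.Motives
  Literature.AlgebraicGeometry.HodgeTheory
open Literature.AlgebraicTopology.SingularHomology
open Summit.HodgeConjecture.HodgeConjecture.Theorems.HeckePrymWeilLine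
  (stub_rationalAlongSection gcs_section_eq_of_eq owf_isoTransport stub_globalClassOfSection_of_leray)
open Summit.HodgeConjecture.HodgeConjecture.Theorems.HyperbolicEightfoldsSqrtMinus7.AnchorObject
  (engine_of_perry complexBetti_map_cupPowTwo cupPowTwo_mem_algebraicClasses_abelian)
open Summit.HodgeConjecture.HodgeConjecture.Theorems (weilSixfolds_iff)

namespace Summit.HodgeConjecture.HodgeConjecture.Cruxes.WeilSixfolds.PerryCmTowerAllD

/-! ### The five registered stubs -/

/-- **Stub 1 — REACH = DELIGNE'S WEIL FAMILY THROUGH `A` WITH A CM TENSOR ANCHOR, every `d`.**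
For `d ≥ 1`, a `√-d`-abelian sixfold `(X, Φ)` (`Φ² = -d`) and a non-zero rational `(3,3)` class `c` of its
strong Weil plane `weilClassesOf X Φ 3 d`: a smooth projective family `f : 𝒳 → S` over a smooth irreducible
quasi-projective base, closed in `ℙᴺ × S`, with a global endomorphism `g` over `S` (`√-d` on every fibre,
abelian charts everywhere), a chart `X ≅ 𝒳_{s₁}` intertwining `Φ` and `g`, a CONTINUOUS section `σ` of
`R⁶f_*ℂ` through `c`, of Hodge type `(3,3)` everywhere, and a CM TENSOR anchor `Y ≅ 𝒳_{s₀}`: `(Y, Ψ)` is in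
flat isogeny correspondence with `(A₁ × A₁, (x,y) ↦ (-d·y, x))`, `A₁` an abelian threefold isogenous to
`E³` for an elliptic curve `E` with `ψ² = -d` (so `Y ~ E⁶`, `E` with CM by an order of `K`), and `σ(s₀)`
lies in the strong Weil plane of `(Y, Ψ)`.  TRUE: Deligne's proof of LNM 900 Thm 4.8 — the hermitian
`K`-lattices of fixed signature `(3,3)` and discriminant form ONE irreducible family over an arithmetic
quotient of `SU(3,3)`, the Weil classes form a flat sub-local-system of Hodge type `(3,3)` fibrewise, and the
diagonal point `(E_K³ ⊗_{𝒪_K} (𝒪_K³, diag form))` of the component is such a CM tensor point (diagonalise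
the `K`-hermitian form; Landherr).  Differs from the sibling route item `HeckePrymWeil.DeligneWeilFamily`
(stmt-16866, `p ≡ 3 (4)` prime `≥ 7`, level structure) only by: every `d ≥ 1`, `k = 3`, and the CM clause on
the anchor.  Lean-XL (Shimura-type family as an abelian scheme; the tree has the carriers
`IsSmoothProjectiveFamily`, `FiberClass`, `fiberOver`).  WHY IT MIGHT FAIL: only formalisation size; for
non-maximal orders `ℤ[√-d]` the component bookkeeping (genus of the hermitian lattice) must be done with
level structure, as in Deligne.
[cite: Deligne1982HodgeCycles, proof of Thm. 4.8 (pp. 47–52), Prop. 4.4, Lemma 4.6]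
[cite: vanGeemen1994HodgeAV, 5.2–5.11] [cite: Landherr1936HermitianForms] -/
theorem stub_cmAnchoredWeilFamilyAllD :
    ∀ d : ℕ, 0 < d → ∀ (X : AbelianVariety ℂ) (Φ : X ⟶ X), X.dim = 2 * 3 → Φ ≫ Φ = -(d • 𝟙 X) → ∀ c : complexBetti X.X (2 * 3), c ∈ weilClassesOf X Φ 3 d → c ≠ 0 → IsRationalClass c → IsOfHodgeType (2 * 3) X.X (2 * 3) 3 3 c → ∃ (𝒳 S : SchemeOver ℂ) (f : 𝒳 ⟶ S) (g : 𝒳 ⟶ 𝒳) (s₁ s₀ : ComplexPoints S) (e : X.X ≅ fiberOver f s₁) (σ : ComplexPoints S → FiberClass f (2 * 3)), IsSmoothProjectiveFamily f (2 * 3) ∧ (∃ (N : ℕ) (ι : 𝒳 ⟶ projectiveSpace N ℂ ⊗ S), IsClosedImmersion ι.left ∧ ι ≫ snd (projectiveSpace N ℂ) S = f) ∧ IrreducibleSpace S.left ∧ AlgebraicGeometry.Smooth S.hom ∧ IsQuasiProjectiveOver S ∧ g ≫ f = f ∧ (∀ s : ComplexPoints S, ∃ (A' : AbelianVariety ℂ)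 (φ' : A' ⟶ A') (e' : A'.X ≅ fiberOver f s), A'.dim = 2 * 3 ∧ φ' ≫ φ' = -(d • 𝟙 A') ∧ (e'.hom ≫ fiberι f s) ≫ g = φ'.hom.hom.hom ≫ (e'.hom ≫ fiberι f s)) ∧ (e.hom ≫ fiberι f s₁) ≫ g = Φ.hom.hom.hom ≫ (e.hom ≫ fiberι f s₁) ∧ Continuous σ ∧ (∀ s, (σ s).pt = s) ∧ (∀ s, IsOfHodgeType (2 * 3) (fiberOver f (σ s).pt) (2 * 3) 3 3 (σ s).cls) ∧ σ s₁ = ⟨s₁, complexBetti.map e.inv (2 * 3) c⟩ ∧ ∃ (Y : AbelianVariety ℂ) (Ψ : Y ⟶ Y) (e₀ : Y.X ≅ fiberOver f s₀) (x : complexBetti (fiberOver f s₀) (2 * 3)), (∃ (A₁ : AbelianVariety ℂ) (f₁ : Y ⟶ A₁.prod A₁) (g₁ : A₁.prod A₁ ⟶ Y) (m : ℕ) (E : AbelianVariety ℂ) (ψ : E ⟶ E) (f₂ : A₁ ⟶ (E.prod E).prod E) (g₂ : (E.prod E).prod E ⟶ A₁) (m₂ : ℕ), A₁.dim = 3 ∧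 Y.dim = 6 ∧ Ψ ≫ Ψ = -(d • 𝟙 Y) ∧ 0 < m ∧ f₁ ≫ g₁ = m • 𝟙 Y ∧ AlgebraicGeometry.Flat f₁.hom.hom.hom.left ∧ g₁ ≫ Ψ = AbelianVariety.prodLift (AbelianVariety.snd A₁ A₁ ≫ (-(d • 𝟙 A₁))) (AbelianVariety.fst A₁ A₁) ≫ g₁ ∧ E.dim = 1 ∧ ψ ≫ ψ = -(d • 𝟙 E) ∧ 0 < m₂ ∧ f₂ ≫ g₂ = m₂ • 𝟙 A₁) ∧ (e₀.hom ≫ fiberι f s₀) ≫ g = Ψ.hom.hom.hom ≫ (e₀.hom ≫ fiberι f s₀) ∧ σ s₀ = ⟨s₀, x⟩ ∧ complexBetti.map e₀.hom (2 * 3) x ∈ weilClassesOf Y Ψ 3 d := by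
  sorry

/-- **Stub 2 — PERRY'S THEOREM, full semiregularity** (named claim-fact of the tree
`HodgeTheory.Perry2026_semiregularFull_remainsAlgebraic`; Perry arXiv:2604.00511 Thm 1.1 (2) ⊇ Buchweitz–Flenner
2003 Thm 5.1 + Baire/CDK propagation).  TRUE in print; Lean-XL.  Shared verbatim with `stub_perryFull` of the
sibling skeletons (1260 `semihomogeneous_perry_design`, 14642, 1262).  It is DISCRIMINANT-FREE and `d`-FREE —
the "new algebraicity criterion valid for all discriminants simultaneously" that arXiv:2603.20268 p. 5 asks for
is not needed: the criterion exists, the missing input is the OBJECT (Stub 5).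
[cite: Perry2026Semiregularity, Thm. 1.1 (2), Def. 2.4] [cite: BuchweitzFlenner2003, Thm. 5.1, Def. 4.1] -/
theorem stub_perryFull : Perry2026_semiregularFull_remainsAlgebraic := by
  sorry

/-- **Stub 3 — A STANDARD CHERN CHARACTER on the tree's real carriers** (construction debt
`Nonempty HodgeTheory.StandardChernCharacterBetti`; Hirzebruch / Grothendieck).  TRUE; Lean-L/XL; shared with
the sibling skeletons.
[cite: Fulton1998, §3.2 and Example 3.2.3] [cite: Hartshorne1977, Appendix A §3–4] -/
theorem stub_chernCharacter : Nonempty StandardChernCharacterBetti := by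
  sorry

/-- **Stub 4 — MARKMAN'S THEOREM FOR HYPERBOLIC SIXFOLDS, every `d`** (named fact of the tree
`HodgeTheory.Markman2025_weilClasses_algebraic_hyperbolicSixfold`; Markman arXiv:2502.03415 Thm 1.5.1, the
split / discriminant `-1` component, all imaginary quadratic `K`).  TRUE in print; Lean-XL; it is also
`stub_hyperbolicSixfolds` of this crux's `Lines/birth.lean` and `stub_markmanSplit` of the sibling.  Used for
the `A`'s whose family has a HYPERBOLIC CM anchor (by `isHyperbolicWeilType_transport`, proved below).
[cite: Markman2025SecantWeil, Thm. 1.5.1 (with Thm. 1.4.1 and §1.2)] [cite: Markman2025SurveySecant, Thm. 1.2] -/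
theorem stub_markmanSplit : Markman2025_weilClasses_algebraic_hyperbolicSixfold := by
  sorry

/-- **Stub 5 (NEW, hardest; open) — A POLARISED, WEIL-CHARGED, FULLY SEMIREGULAR VECTOR BUNDLE ON THE
CM TENSOR SIXFOLD OF EVERY NON-HYPERBOLIC COMPONENT, every `d`.**  For every standard Chern character `C`,
every `d ≥ 1`, every complex abelian sixfold `(Y, Ψ)`, `Ψ² = -d`, in flat isogeny correspondence with a tensor
point `(A₁ × A₁, (x,y) ↦ (-d·y, x))`, `A₁` a threefold ISOGENOUS TO `E³`, `E` an elliptic curve carrying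
`ψ² = -d` (so `Y ~ E⁶` with `E` CM by an order of `K = ℚ(√-d)`, `NS(Y)_ℚ ≅ Herm₆(K)` of rank 36, and the
derived category of `Y` is generated by CM line bundles and their semi-homogeneous descendants), every
projective embedding `ι : Y ↪ ℙᴺ` with non-zero rational `a ∈ H²(ℙᴺ)` — giving the `K`-SYMMETRISED hyperplane
class `θ = d·ι^*a + Ψ^*ι^*a` — and every non-zero rational `(3,3)` class `x` of the strong Weil plane
`weilClassesOf Y Ψ 3 d`: EITHER `(Y, Ψ, θ)` is of hyperbolic Weil type (then Stub 4 takes over along the family),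
OR on every `ℂ`-scheme `F₀ ≅ Y` there is a finite locally free `E₀`, SEMIREGULAR in the full Buchweitz–Flenner
sense (`IsISemiregular hE₀ Set.univ`), with `ch_k(E₀) = q_k·θ^k` for `k ≠ 3` and `ch₃(E₀) = q₃·θ³ + r·x`,
`r ∈ ℚˣ`.  WHY PLAUSIBLY TRUE / THE WORK.  The CLASS `q·e^θ + r·x` is algebraic on the CM sixfold (`x` is a
sum of products of CM divisor classes on `E⁶`; Hazama / Murty: the Hodge ring of `E^n`, `E` CM, is generated by
divisors), so the content is FULL SEMIREGULARITY OF A LOCALLY FREE REPRESENTATIVE with polarization ballast.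
Intended witnesses: MASSEY-RIGIDIFIED INDEX TOWERS of simple semi-homogeneous bundles `F_t` of slopes
`D_t ∈ NS(E⁶)_ℚ` (Mukai: they exist for every rational slope, `ch(F_t) = r(D_t)·e^{D_t}`,
`Ext^*(F_t,F_t) = H^*(𝒪)`, every `Ext^*(F_s,F_t)` concentrated in the Mumford index of `D_t - D_s`), glued
NON-SPLIT so that the identity classes `id_{F_t} ∈ Ext²` die and the trace alone survives, with total `ch` in
`ℚ[θ] ⊕ ℚˣ·x` — semiregularity is then FINITE `K`-ARITHMETIC, design by design.  HONOURS the sibling's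
no-gos: NOT direct sums (a direct sum of individually Weil-dirty summands is never semiregular: for `u` tangent
to the Weil deformation `σ(ob_{E_i}(u)) = u ⌟ ch(E_i) ≠ 0` while `u ⌟ ch(E) = 0` — Markman's
lemma "kernel of `ob_E` = annihilator of `ch(E)`", arXiv:2502.03415 p. 6 — this seat's B4 sharpening, census
§Transfer), NOT index-0 kernels / single extensions (F3-derivation no-go, sibling census s2 §4 N-5, kit
j024611/j024670/j024891/j024926), NOT sub-torus lci designs (p139827: empty).  WHY IT MIGHT FAIL.  (i) no
Massey-rigid tower with clean-plus-charged `ch` may exist on `E⁶` (the moment system F0 has real solutions with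
13–25 atoms, sibling kit j012576/j012597/j012845 at `d = 7`, but integrality tied to the ranks `r(D_t)` and the
killing of ALL identity classes are unverified for any `d`); (ii) the ∀ over `θ` (every `K`-symmetrised very ample
class) — designs give a cone of `(θ, x)` per anchor; (iii) no semiregular sheaf with non-zero Weil charge is known
on any NON-split Weil-type abelian variety (Markman's secant sheaves live on `X × X̂`, reflexive, discriminant
`-1` only — arXiv:2603.20268 p. 5: "constructing the secant sheaf without its geometric input — an open problem in
sheaf theory").  NOT implied by the crux (it produces a sheaf, not a cycle); implies it only through Stubs 1–4.
Differs from the sibling's `stub_polarisedSemiregularBundleSix` by: every `d` (not `7`), and the CM clause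
(`A₁ ~ E³`) in the hypotheses — the ∀-burden is cut from "every tensor-type sixfold" to "the CM sixfolds".
[informal size L/XL; open]
[cite: Mukai1978SemiHomogeneous, Thm. 5.8, Prop. 6.22, Thm. 7.11] [cite: BuchweitzFlenner2003, Def. 4.1, Thm. 5.1]
[cite: Perry2026Semiregularity, Def. 2.4, Thm. 1.1 (2)] [cite: Markman2025SecantWeil, §1.2, Lemma 8.2.1]
[cite: Mumford1970AbelianVarieties, §16 (index theorem)] -/
theorem stub_polarisedSemiregularTowerSixAllD :
    ∀ (C : StandardChernCharacterBetti) (d : ℕ), 0 < d → ∀ (Y : AbelianVariety ℂ) (Ψ : Y ⟶ Y) (A₁ : AbelianVariety ℂ) (f₁ : Y ⟶ A₁.prod A₁) (g₁ : A₁.prod A₁ ⟶ Y) (m : ℕ) (E : AbelianVariety ℂ) (ψ : E ⟶ E) (f₂ : A₁ ⟶ (E.prod E).prod E) (g₂ : (E.prod E).prod E ⟶ A₁) (m₂ : ℕ), A₁.dim = 3 → Y.dim = 6 → Ψ ≫ Ψ = -(d • 𝟙 Y) → 0 < m → f₁ ≫ g₁ = m • 𝟙 Y → AlgebraicGeometry.Flat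 f₁.hom.hom.hom.left → g₁ ≫ Ψ = AbelianVariety.prodLift (AbelianVariety.snd A₁ A₁ ≫ (-(d • 𝟙 A₁))) (AbelianVariety.fst A₁ A₁) ≫ g₁ → E.dim = 1 → ψ ≫ ψ = -(d • 𝟙 E) → 0 < m₂ → f₂ ≫ g₂ = m₂ • 𝟙 A₁ → ∀ (ι : ProjectiveEmbedding Y.X) (a : complexBetti (projectiveSpace ι.n ℂ) 2), IsRationalClass a → a ≠ 0 → ∀ (x : complexBetti Y.X (2 * 3)), IsRationalClass x → IsOfHodgeType 6 Y.X (2 * 3) 3 3 x → x ∈ weilClassesOf Y Ψ 3 d → x ≠ 0 → Literature.AlgebraicGeometry.Motives.IsHyperbolicWeilType Y Ψ 3 ((d : ℂ) • complexBetti.map ι.ι 2 a + complexBetti.map Ψ.hom.hom.hom 2 (complexBetti.map ι.ι 2 a)) ∨ ∀ (F₀ : SchemeOver ℂ) (e₀ : Y.X ≅ F₀), ∃ (E₀ : F₀.left.Modules) (hE₀ : IsFiniteLocallyFree E₀) (q : ℕ → ℚ) (r : ℚ), r ≠ 0 ∧ IsISemiregular hE₀ Set.univ ∧ (∀ k : ℕ,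 k ≠ 3 → C.ch F₀ E₀ k = ((q k : ℚ) : ℂ) • complexBetti.map e₀.inv (2 * k) (cupPowTwo ((d : ℂ) • complexBetti.map ι.ι 2 a + complexBetti.map Ψ.hom.hom.hom 2 (complexBetti.map ι.ι 2 a)) k)) ∧ C.ch F₀ E₀ 3 = complexBetti.map e₀.inv (2 * 3) (((q 3 : ℚ) : ℂ) • cupPowTwo ((d : ℂ) • complexBetti.map ι.ι 2 a + complexBetti.map Ψ.hom.hom.hom 2 (complexBetti.map ι.ι 2 a)) 3 + ((r : ℚ) : ℂ) • x) := by
  sorry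

/-! ### Proved helper: hyperbolicity is constant along the family (every `d`) -/

/-- Round trip along an isomorphism of `ℂ`-schemes: `e.hom^* (e.inv^* x) = x`. -/
private theorem map_hom_map_inv_apply {X Y : SchemeOver ℂ} (e : X ≅ Y) (k : ℕ)
    (x : complexBetti X k) : complexBetti.map e.hom k (complexBetti.map e.inv k x) = x := by
  rw [← CategoryTheory.comp_apply, ← complexBetti.map_comp, Iso.hom_inv_id, complexBetti.map_id,
    CategoryTheory.id_apply]

/-- Round trip along an isomorphism of `ℂ`-schemes: `e.inv^* (e.hom^* y) = y`. -/
private theorem map_inv_map_hom_apply {X Y : SchemeOver ℂ} (e : X ≅ Y) (k : ℕ)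
    (y : complexBetti Y k) : complexBetti.map e.inv k (complexBetti.map e.hom k y) = y := by
  rw [← CategoryTheory.comp_apply, ← complexBetti.map_comp, Iso.inv_hom_id, complexBetti.map_id,
    CategoryTheory.id_apply]

/-- Contravariant functoriality on elements: `a^* (b^* z) = (a ≫ b)^* z`. -/
private theorem map_map_apply {X Y Z : SchemeOver ℂ} (a : X ⟶ Y) (b : Y ⟶ Z) (k : ℕ)
    (z : complexBetti Z k) :
    complexBetti.map a k (complexBetti.map b k z) = complexBetti.map (a ≫ b) k z := by
  rw [complexBetti.map_comp, CategoryTheory.comp_apply]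

/-- **HYPERBOLICITY IS CONSTANT ALONG A WEIL FAMILY OF SIXFOLDS (every `d`; PROVED).**  Along a smooth projective
family `f : 𝒳 ⟶ S` of relative dimension `6` over a smooth irreducible quasi-projective base with a global
endomorphism `g` over `S` and a global class `Θ ∈ H²(𝒳)`, for two fibres with abelian charts `e : A ≅ 𝒳_s`,
`e' : A' ≅ 𝒳_{s'}` intertwining `g` with `φ`, `φ'`: if `(A, φ, e^*Θ_s)` is of hyperbolic Weil type, so is
`(A', φ', e'^*Θ_{s'})`.  This is the `d`-free content of the sibling's landed `stub_hyperbolicFlat` (p156265,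
whose proof never used `φ² = -7`): parallel transport in the local system `R¹f_*ℂ` along a path is injective
linear, preserves rationality, intertwines the fibre maps of `g`, and respects the polarization pairings of the
restrictions of the ONE global class `Θ`.
[cite: VoisinHodgeII2003, §3.1.2 (local systems and flat transport)]
[cite: vanGeemen1994HodgeAV, 5.2–5.4 (hyperbolic = det H ≡ (-1)ⁿ)] -/
theorem isHyperbolicWeilType_transport :
    ∀ (𝒳 S : SchemeOver ℂ) (f : 𝒳 ⟶ S) (g : 𝒳 ⟶ 𝒳), IsSmoothProjectiveFamily f (2 * 3) → IrreducibleSpace S.left → AlgebraicGeometry.Smooth S.hom → IsQuasiProjectiveOver S → g ≫ f = f → ∀ (Θ : complexBetti 𝒳 2) (s s' : ComplexPoints S) (A : AbelianVariety ℂ) (φ : A ⟶ A) (e : A.X ≅ fiberOver f s) (A' : AbelianVariety ℂ) (φ' : A' ⟶ A') (e' : A'.X ≅ fiberOver f s'), (e.hom ≫ fiberι f s) ≫ g = φ.hom.hom.hom ≫ (e.hom ≫ fiberι f s) → (e'.hom ≫ fiberι f s') ≫ g = φ'.hom.hom.hom ≫ (e'.hom ≫ fiberι f s') → Literature.AlgebraicGeometry.Motives.IsHyperbolicWeilType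 A φ 3 (complexBetti.map e.hom 2 (complexBetti.map (fiberι f s) 2 Θ)) → Literature.AlgebraicGeometry.Motives.IsHyperbolicWeilType A' φ' 3 (complexBetti.map e'.hom 2 (complexBetti.map (fiberι f s') 2 Θ)) := by
  intro 𝒳 S f g hfam hirr hsm hSqp hg Θ s s' A φ e A' φ' e' he he' hhyp
  -- the base: `S(ℂ)` is a path-connected manifold and `R• f_* ℂ` is a local system on it
  haveI := hsm
  haveI := hirr
  haveI : LocallyOfFiniteType S.hom := hSqp.locallyOfFiniteType
  haveI : ConnectedSpace (ComplexPoints S) :=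
    (Motives.ComplexPoints.connectedSpace_iff_holds S).2 inferInstance
  obtain ⟨d, hd⟩ := exists_smoothOfRelativeDimension_of_connectedSpace_complexPoints S
  haveI := hd
  haveI := pathConnectedSpace_complexPoints_of_smoothOfRelativeDimension S d
  have hU := isCohomologicallyLocallyTrivialOn_univ_of_isSmoothProjectiveFamily f d hfam hSqp
  -- the fibre maps of `g`
  choose gf hgf using fun t ↦ exists_fiberHom_comp_fiberι f g hg t
  -- view `s`, `s'` as points of the (trivialising) subset `univ ⊆ S(ℂ)` and join them by a path
  obtain ⟨xs, rfl⟩ : ∃ xs : (Set.univ : Set (ComplexPoints S)), (xs : ComplexPoints S) = s :=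
    ⟨⟨s, Set.mem_univ s⟩, rfl⟩
  obtain ⟨xs', rfl⟩ : ∃ xs' : (Set.univ : Set (ComplexPoints S)), (xs' : ComplexPoints S) = s' :=
    ⟨⟨s', Set.mem_univ s'⟩, rfl⟩
  haveI : PathConnectedSpace (Set.univ : Set (ComplexPoints S)) :=
    isPathConnected_iff_pathConnectedSpace.1 (pathConnectedSpace_iff_univ.1 inferInstance)
  let γ : Path xs xs' := PathConnectedSpace.somePath xs xs'
  -- the transport `L := e'^* ∘ γ_* ∘ e^{-1 *} : H¹(A) → H¹(A')`, an injective linear map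
  obtain ⟨L, hL⟩ : ∃ L : complexBetti A.X 1 →ₗ[ℂ] complexBetti A'.X 1, ∀ x, L x =
      complexBetti.map e'.hom 1 (transportFun f 1 hU ⟦γ⟧ (complexBetti.map e.inv 1 x)) :=
    ⟨(complexBetti.map e'.hom 1).hom ∘ₗ transportLinear f 1 hU ⟦γ⟧ ∘ₗ (complexBetti.map e.inv 1).hom,
      fun x ↦ rfl⟩
  have heg : e.hom ≫ gf xs = φ.hom.hom.hom ≫ e.hom :=
    hom_comp_fiberHom_eq_of_comp_fiberι f g (hgf xs) e φ.hom.hom.hom he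
  have heg' : e'.hom ≫ gf xs' = φ'.hom.hom.hom ≫ e'.hom :=
    hom_comp_fiberHom_eq_of_comp_fiberι f g (hgf xs') e' φ'.hom.hom.hom he'
  have hinjB : Function.Injective (complexBetti.map e.inv 1) :=
    Function.LeftInverse.injective (g := complexBetti.map e.hom 1) fun x ↦ map_hom_map_inv_apply e 1 x
  have hinjA : Function.Injective (complexBetti.map e'.hom 1) :=
    Function.LeftInverse.injective (g := complexBetti.map e'.inv 1) fun y ↦ map_inv_map_hom_apply e' 1 y
  have hinjT := transportFun_injective f 1 hU ⟦γ⟧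
  have hLinj : Function.Injective L := by
    intro x y hxy
    rw [hL, hL] at hxy
    exact hinjB (hinjT (hinjA hxy))
  -- the hyperbolic frame on `A` and its transport `L ∘ u` to `A'`
  obtain ⟨u, hrat, hind, hstab, hiso⟩ := hhyp
  refine ⟨fun i ↦ L (u i), fun i ↦ ?_, hind.map_injOn L hLinj.injOn, fun i ↦ ?_, fun i j ↦ ?_⟩
  · -- rationality: `e^{-1 *}`, `γ_*`, `e'^*` preserve rational classes
    beta_reduce
    rw [hL]
    exact (isRationalClass_transportFun_of_isSmoothProjectiveFamily f 1 d hfam hSqp ⟦γ⟧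
      ((hrat i).map (Motives.AlgPoints.mapContinuous (L := ℂ) e.inv))).map
        (Motives.AlgPoints.mapContinuous (L := ℂ) e'.hom)
  · -- `φ'^*`-stability: `φ'^* (L uᵢ) = L (φ^* uᵢ)` and `L` is linear
    beta_reduce
    have hcomp : gf xs ≫ e.inv = e.inv ≫ φ.hom.hom.hom := by
      rw [Iso.comp_inv_eq, Category.assoc, ← heg, Iso.inv_hom_id_assoc]
    have h1 : complexBetti.map (gf xs) 1 (complexBetti.map e.inv 1 (u i)) =
        complexBetti.map e.inv 1 (complexBetti.map φ.hom.hom.hom 1 (u i)) := by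
      rw [map_map_apply, map_map_apply, hcomp]
    have h2 : transportFun f 1 hU ⟦γ⟧ (complexBetti.map (gf xs) 1 (complexBetti.map e.inv 1 (u i))) =
        complexBetti.map (gf xs') 1 (transportFun f 1 hU ⟦γ⟧ (complexBetti.map e.inv 1 (u i))) :=
      transportFun_map_fiberHom f 1 hU g hg gf hgf ⟦γ⟧ _
    have h3 : ∀ y, complexBetti.map φ'.hom.hom.hom 1 (complexBetti.map e'.hom 1 y) =
        complexBetti.map e'.hom 1 (complexBetti.map (gf xs') 1 y) := fun y ↦ by
      rw [map_map_apply, map_map_apply, heg']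
    have key : complexBetti.map φ'.hom.hom.hom 1 (L (u i)) =
        L (complexBetti.map φ.hom.hom.hom 1 (u i)) := by
      rw [hL, hL, h3, ← h2, h1]
    have hrange : Set.range (fun i ↦ L (u i)) = L '' Set.range u := Set.range_comp L u
    rw [key, hrange, Submodule.span_image]
    exact Submodule.mem_map_of_mem (hstab i)
  · -- isotropy: `Q_{e'^*Θ_{s'}}(L uᵢ, L uⱼ) = e'^* γ_* e^{-1 *} Q_{e^*Θ_s}(uᵢ, uⱼ) = 0`
    beta_reduce
    rw [hL, hL, ← map_polarizationPairingOne]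
    have h4 : polarizationPairingOne (fiberOver f xs') (complexBetti.map (fiberι f xs') 2 Θ) (2 * 3 - 1)
          (transportFun f 1 hU ⟦γ⟧ (complexBetti.map e.inv 1 (u i)))
          (transportFun f 1 hU ⟦γ⟧ (complexBetti.map e.inv 1 (u j))) =
        transportFun f (2 + 2 * (2 * 3 - 1)) hU ⟦γ⟧
          (polarizationPairingOne (fiberOver f xs) (complexBetti.map (fiberι f xs) 2 Θ) (2 * 3 - 1)
            (complexBetti.map e.inv 1 (u i)) (complexBetti.map e.inv 1 (u j))) :=
      (transportFun_polarizationPairingOne f hU Θ ⟦γ⟧ (2 * 3 - 1) _ _).symm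
    have h5 : polarizationPairingOne (fiberOver f xs) (complexBetti.map (fiberι f xs) 2 Θ) (2 * 3 - 1)
          (complexBetti.map e.inv 1 (u i)) (complexBetti.map e.inv 1 (u j)) = 0 := by
      have h6 : complexBetti.map (fiberι f xs) 2 Θ =
          complexBetti.map e.inv 2 (complexBetti.map e.hom 2 (complexBetti.map (fiberι f xs) 2 Θ)) :=
        (map_inv_map_hom_apply e 2 _).symm
      rw [h6, ← map_polarizationPairingOne, hiso i j, map_zero]
    rw [h4, h5, transportFun_zero, map_zero]

/-! ### The composition (concludes the crux BY NAME through the landed `weilSixfolds_iff`) -/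

/-- **The crux, in its `weilClassesOf` form, from the five stubs taken as HYPOTHESES** (all-`d` port of the
sibling's `weilSixfoldsSqrtMinus7_of_hypotheses`, lead c12 r3; sorry-free).  Given `d ≥ 1`, `(A, φ)`, `φ² = -d`,
and a non-zero rational `(3,3)` class `c` of the strong Weil plane: Stub 1 gives the family `f : 𝒳 → S` through
`e : A ≅ 𝒳_{s₁}` with `g`, the continuous fibrewise-Hodge Weil section `σ` through `c`, rational along `σ`
(`stub_rationalAlongSection`, landed), globalised to `W ∈ H⁶(𝒳)` by the PROVED Leray engine, and the CM anchor
`e₀ : Y ≅ 𝒳_{s₀}` with `σ(s₀) ≠ 0` (identity principle) in the strong Weil plane of `(Y, Ψ)`; the fibres embed in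
one `ℙᵐ` by `ε`, a non-zero rational `a ∈ H²(ℙᵐ)` exists and `Θ_K := d·ε^*a + g^*ε^*a` is a GLOBAL class with
rational `(1,1)` fibre restrictions, `e₀`-transported at `s₀` to the bet's `θ`; at a HYPERBOLIC anchor
`isHyperbolicWeilType_transport` makes `A` hyperbolic and Stub 4 (Markman) concludes; otherwise Stubs 3 and 5 give
`E₀` on `𝒳_{s₀}`; `engine_of_perry` (Stub 2) makes `q₃·Θ_K|_{s₁}³ + r·W|_{s₁}` algebraic; `Θ_K|_{s₁}³` is
algebraic on the abelian `A ≅ 𝒳_{s₁}` (Lefschetz `(1,1)`, discharged, + Kleiman); hence `r·e^{-1*}c`, hence `c`,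
is algebraic (`IsoInvariance`, proved).  CONDITIONAL: nothing is asserted beyond the five hypotheses.
[cite: Deligne1982HodgeCycles, proof of Thm. 4.8 (pp. 47–52) with Prop. 4.4]
[cite: Perry2026Semiregularity, Thm. 1.1 (2)] [cite: VoisinHodgeII2003, Thm. 4.18 and §9.2.4 Prop. 9.20] -/
theorem weilSixfolds_of_hypotheses :
    (∀ d : ℕ, 0 < d → ∀ (X : AbelianVariety ℂ) (Φ : X ⟶ X), X.dim = 2 * 3 → Φ ≫ Φ = -(d • 𝟙 X) → ∀ c : complexBetti X.X (2 * 3), c ∈ weilClassesOf X Φ 3 d → c ≠ 0 → IsRationalClass c → IsOfHodgeType (2 * 3) X.X (2 * 3) 3 3 c → ∃ (𝒳 S : SchemeOver ℂ) (f : 𝒳 ⟶ S) (g : 𝒳 ⟶ 𝒳) (s₁ s₀ : ComplexPoints S) (e : X.X ≅ fiberOver f s₁) (σ : ComplexPoints S → FiberClass f (2 * 3)), IsSmoothProjectiveFamily f (2 * 3) ∧ (∃ (N : ℕ) (ι : 𝒳 ⟶ projectiveSpace N ℂ ⊗ S), IsClosedImmersion ι.left ∧ ι ≫ snd (projectiveSpace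 N ℂ) S = f) ∧ IrreducibleSpace S.left ∧ AlgebraicGeometry.Smooth S.hom ∧ IsQuasiProjectiveOver S ∧ g ≫ f = f ∧ (∀ s : ComplexPoints S, ∃ (A' : AbelianVariety ℂ) (φ' : A' ⟶ A') (e' : A'.X ≅ fiberOver f s), A'.dim = 2 * 3 ∧ φ' ≫ φ' = -(d • 𝟙 A') ∧ (e'.hom ≫ fiberι f s) ≫ g = φ'.hom.hom.hom ≫ (e'.hom ≫ fiberι f s)) ∧ (e.hom ≫ fiberι f s₁) ≫ g = Φ.hom.hom.hom ≫ (e.hom ≫ fiberι f s₁) ∧ Continuous σ ∧ (∀ s, (σ s).pt = s) ∧ (∀ s, IsOfHodgeType (2 * 3) (fiberOver f (σ s).pt) (2 * 3) 3 3 (σ s).cls) ∧ σ s₁ = ⟨s₁, complexBetti.map e.inv (2 * 3) c⟩ ∧ ∃ (Y : AbelianVariety ℂ) (Ψ : Y ⟶ Y) (e₀ : Y.X ≅ fiberOver f s₀) (x : complexBetti (fiberOver f s₀) (2 * 3)), (∃ (A₁ : AbelianVariety ℂ) (f₁ : Y ⟶ A₁.prod A₁) (g₁ : A₁.prod A₁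 ⟶ Y) (m : ℕ) (E : AbelianVariety ℂ) (ψ : E ⟶ E) (f₂ : A₁ ⟶ (E.prod E).prod E) (g₂ : (E.prod E).prod E ⟶ A₁) (m₂ : ℕ), A₁.dim = 3 ∧ Y.dim = 6 ∧ Ψ ≫ Ψ = -(d • 𝟙 Y) ∧ 0 < m ∧ f₁ ≫ g₁ = m • 𝟙 Y ∧ AlgebraicGeometry.Flat f₁.hom.hom.hom.left ∧ g₁ ≫ Ψ = AbelianVariety.prodLift (AbelianVariety.snd A₁ A₁ ≫ (-(d • 𝟙 A₁))) (AbelianVariety.fst A₁ A₁) ≫ g₁ ∧ E.dim = 1 ∧ ψ ≫ ψ = -(d • 𝟙 E) ∧ 0 < m₂ ∧ f₂ ≫ g₂ = m₂ • 𝟙 A₁) ∧ (e₀.hom ≫ fiberι f s₀) ≫ g = Ψ.hom.hom.hom ≫ (e₀.hom ≫ fiberι f s₀) ∧ σ s₀ = ⟨s₀, x⟩ ∧ complexBetti.map e₀.hom (2 * 3) x ∈ weilClassesOf Y Ψ 3 d) →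
    Perry2026_semiregularFull_remainsAlgebraic → Nonempty StandardChernCharacterBetti →
    Markman2025_weilClasses_algebraic_hyperbolicSixfold →
    (∀ (C : StandardChernCharacterBetti) (d : ℕ), 0 < d → ∀ (Y : AbelianVariety ℂ) (Ψ : Y ⟶ Y) (A₁ : AbelianVariety ℂ) (f₁ : Y ⟶ A₁.prod A₁) (g₁ : A₁.prod A₁ ⟶ Y) (m : ℕ) (E : AbelianVariety ℂ) (ψ : E ⟶ E) (f₂ : A₁ ⟶ (E.prod E).prod E) (g₂ : (E.prod E).prod E ⟶ A₁) (m₂ : ℕ), A₁.dim = 3 → Y.dim = 6 → Ψ ≫ Ψ = -(d • 𝟙 Y) → 0 < m → f₁ ≫ g₁ = m • 𝟙 Y → AlgebraicGeometry.Flat f₁.hom.hom.hom.left → g₁ ≫ Ψ = AbelianVariety.prodLift (AbelianVariety.snd A₁ A₁ ≫ (-(d • 𝟙 A₁))) (AbelianVariety.fst A₁ A₁) ≫ g₁ → E.dim = 1 → ψ ≫ ψ = -(d • 𝟙 E) → 0 < m₂ → f₂ ≫ g₂ = m₂ • 𝟙 A₁ → ∀ (ι : ProjectiveEmbedding Y.X)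 (a : complexBetti (projectiveSpace ι.n ℂ) 2), IsRationalClass a → a ≠ 0 → ∀ (x : complexBetti Y.X (2 * 3)), IsRationalClass x → IsOfHodgeType 6 Y.X (2 * 3) 3 3 x → x ∈ weilClassesOf Y Ψ 3 d → x ≠ 0 → Literature.AlgebraicGeometry.Motives.IsHyperbolicWeilType Y Ψ 3 ((d : ℂ) • complexBetti.map ι.ι 2 a + complexBetti.map Ψ.hom.hom.hom 2 (complexBetti.map ι.ι 2 a)) ∨ ∀ (F₀ : SchemeOver ℂ) (e₀ : Y.X ≅ F₀), ∃ (E₀ : F₀.left.Modules) (hE₀ : IsFiniteLocallyFree E₀) (q : ℕ → ℚ) (r : ℚ), r ≠ 0 ∧ IsISemiregular hE₀ Set.univ ∧ (∀ k : ℕ, k ≠ 3 → C.ch F₀ E₀ k = ((q k : ℚ) : ℂ) • complexBetti.map e₀.inv (2 * k) (cupPowTwo ((d : ℂ) • complexBetti.map ι.ι 2 a + complexBetti.map Ψ.hom.hom.hom 2 (complexBetti.map ι.ι 2 a)) k)) ∧ C.ch F₀ E₀ 3 = complexBetti.map e₀.inv (2 * 3) (((q 3 : ℚ) : ℂ) •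 cupPowTwo ((d : ℂ) • complexBetti.map ι.ι 2 a + complexBetti.map Ψ.hom.hom.hom 2 (complexBetti.map ι.ι 2 a)) 3 + ((r : ℚ) : ℂ) • x)) →
    ∀ (d : ℕ), 0 < d → ∀ (A : AbelianVariety ℂ) (φ : A ⟶ A), A.dim = 2 * 3 →
      Motives.IsSmoothProjective (2 * 3) A.X → φ ≫ φ = -(d • 𝟙 A) →
        ∀ c : complexBetti A.X (2 * 3), IsRationalClass c → IsOfHodgeType (2 * 3) A.X (2 * 3) 3 3 c →
          c ∈ weilClassesOf A φ 3 d → c ∈ algebraicClasses A.X 3 := by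
  intro hS1 hP hC hM hB d hd A φ hA' hAsp hφ c hr hH hcW
  by_cases hc : c = 0
  · rw [hc]
    exact Submodule.zero_mem _
  -- STUB 1: the family through `A` with its CM tensor anchor
  obtain ⟨𝒳, S, f, g, s₁, s₀, e, σ, hfam, hemb, hirr, hsm, hSqp, hg, hfib, he, hσc, hpt, hHσ, hs₁, Y, Ψ,
    e₀, x, ⟨A₁, f₁, g₁, m, E, ψ, f₂, g₂, m₂, hA₁, hY, hΨ, hm, hfg, hf₁, hg₁, hE, hψ, hm₂, hfg₂⟩, he₀, hs₀, hx⟩ :=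
    hS1 d hd A φ hA' hφ c hcW hc hr hH
  -- rationality along the section (landed)
  have hrat₁ : IsRationalClass (σ s₁).cls := by
    rw [hs₁]; exact hr.map _
  have hratσ : ∀ s, IsRationalClass (σ s).cls :=
    stub_rationalAlongSection f (2 * 3) (2 * 3) hfam hsm hSqp hirr σ hσc hpt s₁ hrat₁
  have hratx : IsRationalClass x := by
    have h := hratσ s₀
    rwa [hs₀] at h
  have hHx : IsOfHodgeType 6 (fiberOver f s₀) (2 * 3) 3 3 x := by
    have h := hHσ s₀
    rw [hs₀] at h
    exact h
  -- the base is a connected manifold; `R• f_* ℂ` is a local system on it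
  haveI := hsm
  haveI := hirr
  haveI : LocallyOfFiniteType S.hom := hSqp.locallyOfFiniteType
  haveI : ConnectedSpace (ComplexPoints S) :=
    (ComplexPoints.connectedSpace_iff_holds S).2 inferInstance
  obtain ⟨dS, hdS⟩ := exists_smoothOfRelativeDimension_of_connectedSpace_complexPoints S
  haveI := hdS
  haveI := pathConnectedSpace_complexPoints_of_smoothOfRelativeDimension S dS
  have hU := isCohomologicallyLocallyTrivialOn_univ_of_isSmoothProjectiveFamily f dS hfam hSqp
  -- `x ≠ 0`: a continuous section vanishing at `s₀` vanishes identically (identity principle, landed)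
  have hx0 : x ≠ 0 := by
    intro hx0
    have hzero : σ s₀ = globalSection f (2 * 3) 0 s₀ := by
      rw [hs₀, hx0]
      show (⟨s₀, 0⟩ : FiberClass f (2 * 3)) = ⟨s₀, _⟩
      rw [map_zero]
    have hall := gcs_section_eq_of_eq f (2 * 3) hU hσc hpt (continuous_globalSection f _ 0)
      (fun _ => rfl) hzero s₁
    rw [hs₁] at hall
    have hc' : complexBetti.map e.inv (2 * 3) c = 0 := by
      have h2 := ((FiberClass.clsAt_eq_iff _ rfl _).2 hall.symm).symm
      rw [h2]
      show complexBetti.map (fiberι f s₁) (2 * 3) 0 = 0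
      rw [map_zero]
    apply hc
    have h3 := congrArg (complexBetti.map e.hom (2 * 3)) hc'
    rwa [map_zero, ← CategoryTheory.comp_apply, ← complexBetti.map_comp, Iso.hom_inv_id,
      complexBetti.map_id, CategoryTheory.id_apply] at h3
  -- the PROVED Leray engine: `σ` is the restriction of a global class `W`
  obtain ⟨W, hWσ⟩ := stub_globalClassOfSection_of_leray deligne1968_invariantClass_fromTotalSpace_holds f (2 * 3)
    (2 * 3) hfam hemb hsm hSqp hirr σ hσc hpt
  have hcls : ∀ (s : ComplexPoints S) (y : complexBetti (fiberOver f s) (2 * 3)),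
      σ s = ⟨s, y⟩ → complexBetti.map (fiberι f s) (2 * 3) W = y := by
    intro s y hy
    have h := (hWσ s).symm.trans hy
    simp only [globalSection, FiberClass.mk.injEq, heq_eq_eq, true_and] at h
    exact h
  have hW₁ : complexBetti.map (fiberι f s₁) (2 * 3) W = complexBetti.map e.inv (2 * 3) c := hcls s₁ _ hs₁
  have hW₀ : complexBetti.map (fiberι f s₀) (2 * 3) W = x := hcls s₀ x hs₀
  have hWrat : ∀ s, IsRationalClass (complexBetti.map (fiberι f s) (2 * 3) W) := by
    intro s
    have h := hratσ s
    rw [hWσ s] at h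
    exact h
  have hWH : ∀ s, IsOfHodgeType (2 * 3) (fiberOver f s) (2 * 3) 3 3 (complexBetti.map (fiberι f s) (2 * 3) W) := by
    intro s
    have h := hHσ s
    rw [hWσ s] at h
    exact h
  -- the fibre maps of `g`
  have hgf' := fun t ↦ exists_fiberHom_comp_fiberι f g hg t
  choose gf hgf using hgf'
  -- all fibres embed in ONE projective space `ℙᵐ`, `m ≥ 1`
  obtain ⟨mm, ε, hε⟩ := exists_forall_isClosedImmersion_fiberι_comp f hfam hemb hSqp
  have hPm : IsSmoothProjective mm (projectiveSpace mm ℂ) := isSmoothProjective_projectiveSpace' mm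
  have hmm : 1 ≤ mm := by
    haveI := hε s₀
    obtain ⟨B⟩ := (nonempty_hodgeModel_holds (n := 2 * 3) (X := fiberOver f s₀)).nonempty
      (hfam.isSmoothProjective s₀)
    obtain ⟨Bm⟩ := (nonempty_hodgeModel_holds (n := mm) (X := projectiveSpace mm ℂ)).nonempty hPm
    have h := dim_le_of_isClosedImmersion_projectiveSpace (hfam.isSmoothProjective s₀) (fiberι f s₀ ≫ ε) B Bm
    omega
  obtain ⟨a, ha, ha0⟩ := exists_isRationalClass_ne_zero_projectiveSpace hmm
  have ha11 : IsOfHodgeType mm (projectiveSpace mm ℂ) (2 * 1) 1 1 a :=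
    isOfHodgeType_of_mem_algebraicClasses_of_isSmoothProjective hPm 1
      (by rw [algebraicClasses_projectiveSpace_eq_top]; exact Submodule.mem_top)
  -- the GLOBAL `K`-symmetrised hyperplane class `Θ_K = d·ε^*a + g^*ε^*a` and its fibre restrictions
  set Θ : complexBetti 𝒳 2 := complexBetti.map ε 2 a with hΘdef
  set ΘK : complexBetti 𝒳 2 := (d : ℂ) • Θ + complexBetti.map g 2 Θ with hΘKdef
  -- `θ_s := ι_s^* Θ = (ι_s ≫ ε)^* a`
  have hθs : ∀ s, complexBetti.map (fiberι f s) 2 Θ = complexBetti.map (fiberι f s ≫ ε) 2 a := by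
    intro s
    rw [hΘdef, complexBetti.map_comp, ModuleCat.comp_apply]
  have hΘKs : ∀ s, complexBetti.map (fiberι f s) 2 ΘK =
      (d : ℂ) • complexBetti.map (fiberι f s) 2 Θ +
        complexBetti.map (gf s) 2 (complexBetti.map (fiberι f s) 2 Θ) := by
    intro s
    rw [hΘKdef, map_add, map_smul, ← ModuleCat.comp_apply (complexBetti.map g 2),
      ← complexBetti.map_comp, ← hgf s, complexBetti.map_comp, ModuleCat.comp_apply]
  -- `Θ_K|_{𝒳_s}` is rational of type `(1,1)` on every fibre
  have hΘKfib : ∀ s, IsRationalClass (complexBetti.map (fiberι f s) 2 ΘK) ∧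
      IsOfHodgeType (2 * 3) (fiberOver f s) 2 1 1 (complexBetti.map (fiberι f s) 2 ΘK) := by
    intro s
    have hsp := hfam.isSmoothProjective s
    have hrat' : IsRationalClass (complexBetti.map (fiberι f s) 2 Θ) := by
      rw [hθs s]; exact ha.map _
    have h7' : IsOfHodgeType (2 * 3) (fiberOver f s) 2 1 1 (complexBetti.map (fiberι f s) 2 Θ) := by
      rw [hθs s]; exact ha11.map_of_isSmoothProjective hsp hPm _
    rw [hΘKs s]
    refine ⟨?_, (h7'.smul _).add hsp (h7'.map_of_isSmoothProjective hsp hsp _)⟩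
    have h7 : ((d : ℚ) : ℂ) • complexBetti.map (fiberι f s) 2 Θ = (d : ℂ) • complexBetti.map (fiberι f s) 2 Θ := by
      rw [Rat.cast_natCast]
    rw [← h7]
    exact (hrat'.smul (d : ℚ)).add (hrat'.map _)
  -- the anchor's embedding `Y ≅ 𝒳_{s₀} ↪ ℙᵐ` and the bet's `K`-symmetrised class `θ` through `e₀`
  haveI : IsIso e₀.hom.left :=
    ⟨e₀.inv.left, by rw [← Over.comp_left, e₀.hom_inv_id, Over.id_left],
      by rw [← Over.comp_left, e₀.inv_hom_id, Over.id_left]⟩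
  haveI := hε s₀
  haveI : IsClosedImmersion (e₀.hom ≫ (fiberι f s₀ ≫ ε)).left := by
    rw [Over.comp_left]
    infer_instance
  let ιY : ProjectiveEmbedding Y.X := ⟨mm, e₀.hom ≫ (fiberι f s₀ ≫ ε), inferInstance⟩
  have he₀' : e₀.hom ≫ gf s₀ = Ψ.hom.hom.hom ≫ e₀.hom :=
    hom_comp_fiberHom_eq_of_comp_fiberι f g (hgf s₀) e₀ Ψ.hom.hom.hom he₀
  have hιa : complexBetti.map ιY.ι 2 a = complexBetti.map e₀.hom 2 (complexBetti.map (fiberι f s₀) 2 Θ) := by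
    show complexBetti.map (e₀.hom ≫ (fiberι f s₀ ≫ ε)) 2 a = _
    rw [complexBetti.map_comp, ModuleCat.comp_apply, hθs s₀]
  have hθY : complexBetti.map e₀.inv 2
      ((d : ℂ) • complexBetti.map ιY.ι 2 a + complexBetti.map Ψ.hom.hom.hom 2 (complexBetti.map ιY.ι 2 a)) =
      complexBetti.map (fiberι f s₀) 2 ΘK := by
    rw [hιa, map_add, map_smul, e₀.complexBetti_map_inv_map_hom, hΘKs s₀]
    congr 1
    rw [← ModuleCat.comp_apply (complexBetti.map e₀.hom 2), ← complexBetti.map_comp,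
      ← ModuleCat.comp_apply (complexBetti.map (Ψ.hom.hom.hom ≫ e₀.hom) 2), ← complexBetti.map_comp,
      ← he₀', e₀.inv_hom_id_assoc]
  -- the Weil class read on `Y`
  have hxY0 : complexBetti.map e₀.hom (2 * 3) x ≠ 0 := by
    intro h0
    apply hx0
    have h3 := congrArg (complexBetti.map e₀.inv (2 * 3)) h0
    rwa [map_zero, e₀.complexBetti_map_inv_map_hom] at h3
  have hxYH : IsOfHodgeType 6 Y.X (2 * 3) 3 3 (complexBetti.map e₀.hom (2 * 3) x) := hHx.map_of_iso e₀
  -- STUB 3: a standard Chern character; STUB 5: the polarised semiregular object on `𝒳_{s₀} ≅ Y`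
  obtain ⟨C⟩ := hC
  rcases hB C d hd Y Ψ A₁ f₁ g₁ m E ψ f₂ g₂ m₂ hA₁ hY hΨ hm hfg hf₁ hg₁ hE hψ hm₂ hfg₂ ιY a ha ha0
      (complexBetti.map e₀.hom (2 * 3) x) (hratx.map _) hxYH hx hxY0 with hhypY | hBet
  · /- HYPERBOLIC ANCHOR: hyperbolicity is constant along the family (proved helper), so `A` is hyperbolic for
       the `K`-symmetrised hyperplane class of the embedding `e ≫ ι_{s₁} ≫ ε`, and Markman's theorem (Stub 4)
       gives the claim directly. -/
    have hθY' : complexBetti.map e₀.hom 2 (complexBetti.map (fiberι f s₀) 2 ΘK) =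
        (d : ℂ) • complexBetti.map ιY.ι 2 a + complexBetti.map Ψ.hom.hom.hom 2 (complexBetti.map ιY.ι 2 a) := by
      rw [← hθY, ← CategoryTheory.comp_apply, ← complexBetti.map_comp, Iso.hom_inv_id, complexBetti.map_id,
        CategoryTheory.id_apply]
    rw [← hθY'] at hhypY
    -- the embedding of `A` through its chart and the `K`-symmetrised class at `s₁`
    haveI : IsIso e.hom.left :=
      ⟨e.inv.left, by rw [← Over.comp_left, e.hom_inv_id, Over.id_left],
        by rw [← Over.comp_left, e.inv_hom_id, Over.id_left]⟩
    haveI := hε s₁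
    haveI : IsClosedImmersion (e.hom ≫ (fiberι f s₁ ≫ ε)).left := by
      rw [Over.comp_left]
      infer_instance
    let ιA : ProjectiveEmbedding A.X := ⟨mm, e.hom ≫ (fiberι f s₁ ≫ ε), inferInstance⟩
    have he' : e.hom ≫ gf s₁ = φ.hom.hom.hom ≫ e.hom :=
      hom_comp_fiberHom_eq_of_comp_fiberι f g (hgf s₁) e φ.hom.hom.hom he
    have hιAa : complexBetti.map ιA.ι 2 a = complexBetti.map e.hom 2 (complexBetti.map (fiberι f s₁) 2 Θ) := by
      show complexBetti.map (e.hom ≫ (fiberι f s₁ ≫ ε)) 2 a = _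
      rw [complexBetti.map_comp, ModuleCat.comp_apply, hθs s₁]
    have hθA : complexBetti.map e.inv 2
        ((d : ℂ) • complexBetti.map ιA.ι 2 a + complexBetti.map φ.hom.hom.hom 2 (complexBetti.map ιA.ι 2 a)) =
        complexBetti.map (fiberι f s₁) 2 ΘK := by
      rw [hιAa, map_add, map_smul, e.complexBetti_map_inv_map_hom, hΘKs s₁]
      congr 1
      rw [← ModuleCat.comp_apply (complexBetti.map e.hom 2), ← complexBetti.map_comp,
        ← ModuleCat.comp_apply (complexBetti.map (φ.hom.hom.hom ≫ e.hom) 2), ← complexBetti.map_comp,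
        ← he', e.inv_hom_id_assoc]
    have hθA' : complexBetti.map e.hom 2 (complexBetti.map (fiberι f s₁) 2 ΘK) =
        (d : ℂ) • complexBetti.map ιA.ι 2 a + complexBetti.map φ.hom.hom.hom 2 (complexBetti.map ιA.ι 2 a) := by
      rw [← hθA, ← CategoryTheory.comp_apply, ← complexBetti.map_comp, Iso.hom_inv_id, complexBetti.map_id,
        CategoryTheory.id_apply]
    -- transport hyperbolicity from the anchor `s₀` to `s₁` (proved helper)
    have hhypA := isHyperbolicWeilType_transport 𝒳 S f g hfam hirr hsm hSqp hg ΘK s₀ s₁ Y Ψ e₀ A φ e he₀ he hhypY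
    rw [hθA'] at hhypA
    -- Stub 4: Markman at `d`
    exact hM d hd A φ hA' hAsp hφ ιA a ha ha0 hhypA c hr hH hcW
  obtain ⟨E₀, hE₀, q, r, hr0, hsr, hEk, hE3⟩ := hBet (fiberOver f s₀) e₀
  have hrC : ((r : ℚ) : ℂ) ≠ 0 := by exact_mod_cast hr0
  -- the Chern character of `E₀` in terms of the GLOBAL classes `Θ_K`, `r • W`
  have hk : ∀ k : ℕ, k ≠ 3 →
      C.ch (fiberOver f s₀) E₀ k = ((q k : ℚ) : ℂ) • cupPowTwo (complexBetti.map (fiberι f s₀) 2 ΘK) k := by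
    intro k hk3
    rw [hEk k hk3, complexBetti_map_cupPowTwo, hθY]
  have hWrat' : ∀ s, IsRationalClass (complexBetti.map (fiberι f s) (2 * 3) (((r : ℚ) : ℂ) • W)) := by
    intro s
    rw [map_smul]
    exact (hWrat s).smul r
  have hWH' : ∀ s, IsOfHodgeType (2 * 3) (fiberOver f s) (2 * 3) 3 3
      (complexBetti.map (fiberι f s) (2 * 3) (((r : ℚ) : ℂ) • W)) := by
    intro s
    rw [map_smul]
    exact (hWH s).smul _
  have hn : C.ch (fiberOver f s₀) E₀ 3 =
      ((q 3 : ℚ) : ℂ) • cupPowTwo (complexBetti.map (fiberι f s₀) 2 ΘK) 3 +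
        complexBetti.map (fiberι f s₀) (2 * 3) (((r : ℚ) : ℂ) • W) := by
    rw [hE3, map_add, map_smul, map_smul, complexBetti_map_cupPowTwo, hθY, e₀.complexBetti_map_inv_map_hom,
      map_smul, hW₀]
  -- STUB 2 through the engine: `q₃·Θ_K|_{s₁}³ + r·W|_{s₁}` is algebraic on `𝒳_{s₁}`
  have halg := engine_of_perry hP 3 f hfam hirr hsm hSqp ΘK hΘKfib (((r : ℚ) : ℂ) • W) hWrat' hWH' s₀
    C.toChernCharacterBetti E₀ hE₀ hsr q hk hn s₁
  -- `Θ_K|_{s₁}³` is algebraic on `𝒳_{s₁}`: Lefschetz (1,1) (discharged) + Kleiman on the abelian `A ≅ 𝒳_{s₁}`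
  have hh₁rat : IsRationalClass (complexBetti.map e.hom 2 (complexBetti.map (fiberι f s₁) 2 ΘK)) :=
    (hΘKfib s₁).1.map _
  have hh₁H : IsOfHodgeType (2 * 3) A.X 2 1 1 (complexBetti.map e.hom 2 (complexBetti.map (fiberι f s₁) 2 ΘK)) :=
    (hΘKfib s₁).2.map_of_iso e
  have hh₁alg : complexBetti.map e.hom 2 (complexBetti.map (fiberι f s₁) 2 ΘK) ∈ algebraicClasses A.X 1 :=
    lefschetzOneOne_rational_holds hAsp _ hh₁rat hh₁H
  have hh₁3 : complexBetti.map e.hom (2 * 3) (cupPowTwo (complexBetti.map (fiberι f s₁) 2 ΘK) 3) ∈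
      algebraicClasses A.X 3 := by
    rw [complexBetti_map_cupPowTwo]
    exact cupPowTwo_mem_algebraicClasses_abelian A hh₁alg 2
  have hΘ3 : cupPowTwo (complexBetti.map (fiberι f s₁) 2 ΘK) 3 ∈ algebraicClasses (fiberOver f s₁) 3 :=
    owf_isoTransport _ A e 3 _ hh₁3
  -- hence `r • W_{s₁} = r • e^{-1*} c`, and so `e^{-1*} c` (`r ≠ 0`), is algebraic on `𝒳_{s₁}`
  have hrW₁alg : ((r : ℚ) : ℂ) • complexBetti.map e.inv (2 * 3) c ∈ algebraicClasses (fiberOver f s₁) 3 := by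
    rw [← hW₁, ← map_smul]
    have h := Submodule.sub_mem _ halg (Submodule.smul_mem _ (((q 3 : ℚ) : ℂ)) hΘ3)
    rwa [add_sub_cancel_left] at h
  have h1 : complexBetti.map e.inv (2 * 3) c ∈ algebraicClasses (fiberOver f s₁) 3 :=
    (Submodule.smul_mem_iff _ hrC).mp hrW₁alg
  -- back along `e : A ≅ 𝒳_{s₁}` (the proved `IsoInvariance`)
  have key := Theorems.isoInvariance_proof e 3 _ h1
  rw [← CategoryTheory.comp_apply, ← complexBetti.map_comp, Iso.hom_inv_id, complexBetti.map_id] at key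
  exact key

/-! ### The crux BY NAME (three definitionally equal route decls) -/

/-- **`WeilSixfolds` (primary decl, route `TropicalCuspLift`) from the five stubs taken as hypotheses**, through the
landed restatement `Theorems.weilSixfolds_iff` (the crux's single-operator eigenspace sum is the strong Weil plane
`weilClassesOf A φ 3 d`).  Sorry-free. -/
theorem WeilSixfolds_of
    (h₁ : ∀ d : ℕ, 0 < d → ∀ (X : AbelianVariety ℂ) (Φ : X ⟶ X), X.dim = 2 * 3 → Φ ≫ Φ = -(d • 𝟙 X) → ∀ c : complexBetti X.X (2 * 3), c ∈ weilClassesOf X Φ 3 d → c ≠ 0 → IsRationalClass c → IsOfHodgeType (2 * 3) X.X (2 * 3) 3 3 c → ∃ (𝒳 S : SchemeOver ℂ) (f : 𝒳 ⟶ S) (g : 𝒳 ⟶ 𝒳) (s₁ s₀ : ComplexPoints S) (e : X.X ≅ fiberOver f s₁) (σ : ComplexPoints S → FiberClass f (2 * 3)), IsSmoothProjectiveFamily f (2 * 3) ∧ (∃ (N : ℕ) (ι : 𝒳 ⟶ projectiveSpace N ℂ ⊗ S), IsClosedImmersion ι.left ∧ ι ≫ snd (projectiveSpace N ℂ) S =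 f) ∧ IrreducibleSpace S.left ∧ AlgebraicGeometry.Smooth S.hom ∧ IsQuasiProjectiveOver S ∧ g ≫ f = f ∧ (∀ s : ComplexPoints S, ∃ (A' : AbelianVariety ℂ) (φ' : A' ⟶ A') (e' : A'.X ≅ fiberOver f s), A'.dim = 2 * 3 ∧ φ' ≫ φ' = -(d • 𝟙 A') ∧ (e'.hom ≫ fiberι f s) ≫ g = φ'.hom.hom.hom ≫ (e'.hom ≫ fiberι f s)) ∧ (e.hom ≫ fiberι f s₁) ≫ g = Φ.hom.hom.hom ≫ (e.hom ≫ fiberι f s₁) ∧ Continuous σ ∧ (∀ s, (σ s).pt = s) ∧ (∀ s, IsOfHodgeType (2 * 3) (fiberOver f (σ s).pt) (2 * 3) 3 3 (σ s).cls) ∧ σ s₁ = ⟨s₁, complexBetti.map e.inv (2 * 3) c⟩ ∧ ∃ (Y : AbelianVariety ℂ) (Ψ : Y ⟶ Y) (e₀ : Y.X ≅ fiberOver f s₀) (x : complexBetti (fiberOver f s₀) (2 * 3)), (∃ (A₁ : AbelianVariety ℂ) (f₁ : Y ⟶ A₁.prod A₁) (g₁ : A₁.prod A₁ ⟶ Y)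 (m : ℕ) (E : AbelianVariety ℂ) (ψ : E ⟶ E) (f₂ : A₁ ⟶ (E.prod E).prod E) (g₂ : (E.prod E).prod E ⟶ A₁) (m₂ : ℕ), A₁.dim = 3 ∧ Y.dim = 6 ∧ Ψ ≫ Ψ = -(d • 𝟙 Y) ∧ 0 < m ∧ f₁ ≫ g₁ = m • 𝟙 Y ∧ AlgebraicGeometry.Flat f₁.hom.hom.hom.left ∧ g₁ ≫ Ψ = AbelianVariety.prodLift (AbelianVariety.snd A₁ A₁ ≫ (-(d • 𝟙 A₁))) (AbelianVariety.fst A₁ A₁) ≫ g₁ ∧ E.dim = 1 ∧ ψ ≫ ψ = -(d • 𝟙 E) ∧ 0 < m₂ ∧ f₂ ≫ g₂ = m₂ • 𝟙 A₁) ∧ (e₀.hom ≫ fiberι f s₀) ≫ g = Ψ.hom.hom.hom ≫ (e₀.hom ≫ fiberι f s₀) ∧ σ s₀ = ⟨s₀, x⟩ ∧ complexBetti.map e₀.hom (2 * 3) x ∈ weilClassesOf Y Ψ 3 d)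
    (h₂ : Perry2026_semiregularFull_remainsAlgebraic) (h₃ : Nonempty StandardChernCharacterBetti)
    (h₄ : Markman2025_weilClasses_algebraic_hyperbolicSixfold)
    (h₅ : ∀ (C : StandardChernCharacterBetti) (d : ℕ), 0 < d → ∀ (Y : AbelianVariety ℂ) (Ψ : Y ⟶ Y) (A₁ : AbelianVariety ℂ) (f₁ : Y ⟶ A₁.prod A₁) (g₁ : A₁.prod A₁ ⟶ Y) (m : ℕ) (E : AbelianVariety ℂ) (ψ : E ⟶ E) (f₂ : A₁ ⟶ (E.prod E).prod E) (g₂ : (E.prod E).prod E ⟶ A₁) (m₂ : ℕ), A₁.dim = 3 → Y.dim = 6 → Ψ ≫ Ψ = -(d • 𝟙 Y) → 0 < m → f₁ ≫ g₁ = m • 𝟙 Y → AlgebraicGeometry.Flat f₁.hom.hom.hom.left → g₁ ≫ Ψ = AbelianVariety.prodLift (AbelianVariety.snd A₁ A₁ ≫ (-(d • 𝟙 A₁))) (AbelianVariety.fst A₁ A₁) ≫ g₁ → E.dim = 1 → ψ ≫ ψ = -(d • 𝟙 E) → 0 < m₂ → f₂ ≫ g₂ = m₂ • 𝟙 A₁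 → ∀ (ι : ProjectiveEmbedding Y.X) (a : complexBetti (projectiveSpace ι.n ℂ) 2), IsRationalClass a → a ≠ 0 → ∀ (x : complexBetti Y.X (2 * 3)), IsRationalClass x → IsOfHodgeType 6 Y.X (2 * 3) 3 3 x → x ∈ weilClassesOf Y Ψ 3 d → x ≠ 0 → Literature.AlgebraicGeometry.Motives.IsHyperbolicWeilType Y Ψ 3 ((d : ℂ) • complexBetti.map ι.ι 2 a + complexBetti.map Ψ.hom.hom.hom 2 (complexBetti.map ι.ι 2 a)) ∨ ∀ (F₀ : SchemeOver ℂ) (e₀ : Y.X ≅ F₀), ∃ (E₀ : F₀.left.Modules) (hE₀ : IsFiniteLocallyFree E₀) (q : ℕ → ℚ) (r : ℚ), r ≠ 0 ∧ IsISemiregular hE₀ Set.univ ∧ (∀ k : ℕ, k ≠ 3 → C.ch F₀ E₀ k = ((q k : ℚ) : ℂ) • complexBetti.map e₀.inv (2 * k) (cupPowTwo ((d : ℂ) • complexBetti.map ι.ι 2 a + complexBetti.map Ψ.hom.hom.hom 2 (complexBetti.map ι.ι 2 a)) k)) ∧ C.ch F₀ E₀ 3 = complexBetti.map e₀.inv (2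 * 3) (((q 3 : ℚ) : ℂ) • cupPowTwo ((d : ℂ) • complexBetti.map ι.ι 2 a + complexBetti.map Ψ.hom.hom.hom 2 (complexBetti.map ι.ι 2 a)) 3 + ((r : ℚ) : ℂ) • x)) :
    Summit.HodgeConjecture.HodgeConjecture.Theses.TropicalCuspLift.WeilSixfolds :=
  weilSixfolds_iff.2 (weilSixfolds_of_hypotheses h₁ h₂ h₃ h₄ h₅)

/-- **`WeilSixfolds` from the five stubs** — the skeleton theorem (concludes the crux BY NAME — the item's primary
decl `…Theses.TropicalCuspLift.WeilSixfolds`; depends on the five stubs' `sorry`s and on nothing else). -/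
theorem WeilSixfolds_of_stubs : Summit.HodgeConjecture.HodgeConjecture.Theses.TropicalCuspLift.WeilSixfolds :=
  WeilSixfolds_of stub_cmAnchoredWeilFamilyAllD stub_perryFull stub_chernCharacter stub_markmanSplit
    stub_polarisedSemiregularTowerSixAllD

/-- The same conclusion for the `SevenfoldWeilCensus` copy of the crux (rank-4 crux of the staffed route; the
three route decls are syntactically identical, so the same term proves it). -/
theorem WeilSixfolds_of_stubs_census :
    Summit.HodgeConjecture.HodgeConjecture.Theses.SevenfoldWeilCensus.WeilSixfolds :=
  WeilSixfolds_of_stubs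

/-- The same conclusion for the `NodalThetaWeil` copy of the crux (that route's TARGET). -/
theorem WeilSixfolds_of_stubs_nodalThetaWeil :
    Summit.HodgeConjecture.HodgeConjecture.Theses.NodalThetaWeil.WeilSixfolds :=
  WeilSixfolds_of_stubs

end Summit.HodgeConjecture.HodgeConjecture.Cruxes.WeilSixfolds.PerryCmTowerAllD

end
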